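import Literature.NumberTheory.EllipticCurves.Gamma0RankinSelbergContinuation
import Mathlib.Analysis.Calculus.Deriv.Star
import HarnessLib

/-!
# The `GL(2)` fields of the Hoffstein–Lockhart datum for `S₂(Γ₀(N))`: the function
# `L_f(s) = ζ(2s) Σ|aₙ|² n^{-(s+1)}/ζ(s)`, holomorphic on a neighbourhood of a disc `|s − 2| ≤ 1 + r`
# uniform in `f` and `N`, with `L_f(1) = 8π³ Re(f,f)/[SL₂(ℤ):Γ₀(N)]`

Topic `Literature/NumberTheory/EllipticCurves`; definitions with bodies (`rankinArch`, `symmSqL`) and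
theorems. Packaging of `Gamma0RankinSelbergContinuation` (`rankinLambda N f`, holomorphic on `Re s > 0`,
`= (s−1)π^{-s}Γ(s)ζ(2s)Γ(s+1)(4π)^{-(s+1)}L(|a|², s+1)` on `Re s > 1`, value `Re(f,f)/(2[SL₂(ℤ):Γ₀(N)])`
at `1`) in the shape of the single-member fields of
`Literature.NumberTheory.LFunctions.SiegelPairFamilyData` (`SiegelTheoremPairAbstract`; the reduction
`murty_petersson_newform_lower_bound_of_siegelPairFamilyData`, `NewformPeterssonSizeSiegelReductionProofs`)
for the symmetric-square family, with Mathlib's `Z = riemannZeta₁ = (s − 1)ζ(s)`: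

* `symmSqL N f s = rankinLambda N f s/(riemannZeta₁ s · rankinArch s)`,
  `rankinArch s = π^{-s}Γ(s)Γ(s+1)(4π)^{-(s+1)}` (entire factors, zero-free on `Re s > 0`);
* `exists_siegel_radius` — **a radius `r ∈ (0, 1/4]` with `ball 2 (1 + 2r) ⊆ {Re s > 0, riemannZeta₁ s ≠ 0}`**
  (only `ζ`: `ζ(s) ≠ 0` for `Re s ≥ 1`, `riemannZeta₁(1) = 1` and continuity at `1`; points of the ball
  with `Re s < 1` are within `√(8r)` of `1`) — so `R = 1 + r ∈ (1, 3/2]`, `U = ball 2 (1 + 2r)` serve ALL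
  members at once;
* `differentiableOn_symmSqL` — `L_f` is holomorphic on `{Re s > 0} ∩ {riemannZeta₁ ≠ 0} ⊇ U`;
* `symmSqL_eq_of_one_lt_re` — on `Re s > 1`, `L_f(s) = ζ(2s) L(|a|², s+1)/ζ(s)`, and
  `riemannZeta₁_mul_symmSqL` — `riemannZeta₁(s) L_f(s) = (s − 1) ζ(2s) L(|a|², s+1)` (the left side of
  the field `coeff₁`; the Dirichlet series `ζ(2s)L(|a|², s+1) = Σ (Σ_{d²m=n}|a_m|²/m) n^{-s}` has
  non-negative coefficients and first coefficient `|a₁|²`);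
* `symmSqL_one` — **`L_f(1) = 8π³ Re(f,f)/[SL₂(ℤ):Γ₀(N)]`** (`= symmSqLOne f/∏_{p∣N}(1 + 1/p)` in the
  normalisation of `CuspFormSymmSquareLSeries`), positive when `(f,f) > 0`.

Not here: the polynomial bound `|L_f| ≤ B N^κ` on the disc (needs the size of `f` at all cusps), the
reality of `L_f` on the real diameter, the pair functions. See the module docstrings of the series.

## References

* R. A. Rankin, Proc. Cambridge Philos. Soc. 35 (1939), Thm. 3; G. Shimura, Proc. LMS 31 (1975);
  J. Hoffstein, P. Lockhart, Ann. of Math. 140 (1994), Thm. 0.1. [cite: HoffsteinLockhart1994, Thm. 0.1 (the family)]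
-/

noncomputable section

open scoped Real Topology MatrixGroups
open Set Filter Metric Complex CongruenceSubgroup
open Literature.NumberTheory.Automorphic

namespace Literature.NumberTheory.EllipticCurves.ModularForms

/-! ### The archimedean factor and the radius -/

/-- **`A(s) = π^{-s} Γ(s) Γ(s+1) (4π)^{-(s+1)}`**. [folklore] -/
def rankinArch (s : ℂ) : ℂ :=
  (π : ℂ) ^ (-s) * Complex.Gamma s * (Complex.Gamma (s + 1) * ((4 * π : ℝ) : ℂ) ^ (-(s + 1)))

/-- `A(s) ≠ 0` for `Re s > 0`. [folklore] -/
theorem rankinArch_ne_zero {s : ℂ} (hs : 0 < s.re) : rankinArch s ≠ 0 := by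
  have hπ : (π : ℂ) ≠ 0 := by exact_mod_cast Real.pi_ne_zero
  have h4π : ((4 * π : ℝ) : ℂ) ≠ 0 := by exact_mod_cast (by positivity : (4 * π : ℝ) ≠ 0)
  refine mul_ne_zero (mul_ne_zero ?_ (Complex.Gamma_ne_zero_of_re_pos hs)) (mul_ne_zero
    (Complex.Gamma_ne_zero_of_re_pos (by simp; linarith)) ?_)
  · exact fun h ↦ hπ ((cpow_eq_zero_iff _ _).mp h).1
  · exact fun h ↦ h4π ((cpow_eq_zero_iff _ _).mp h).1

/-- `A` is holomorphic on `{Re s > 0}`. [folklore] -/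
theorem differentiableOn_rankinArch : DifferentiableOn ℂ rankinArch {s : ℂ | 0 < s.re} := by
  have hπ : (π : ℂ) ≠ 0 := by exact_mod_cast Real.pi_ne_zero
  have h4π : ((4 * π : ℝ) : ℂ) ≠ 0 := by exact_mod_cast (by positivity : (4 * π : ℝ) ≠ 0)
  intro s hs
  have hs' : (0 : ℝ) < s.re := hs
  have hG : DifferentiableAt ℂ Complex.Gamma s :=
    Complex.differentiableAt_Gamma s fun m h ↦ by
      have := congrArg Complex.re h; simp at this; linarith
  have hG1 : DifferentiableAt ℂ (fun s ↦ Complex.Gamma (s + 1)) s := by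
    refine (Complex.differentiableAt_Gamma (s + 1) fun m h ↦ ?_).comp s (differentiableAt_id.add_const 1)
    have := congrArg Complex.re h; simp at this; linarith
  refine (((differentiableAt_id.neg.const_cpow (Or.inl hπ)).mul hG).mul
    (hG1.mul ((differentiableAt_id.add_const 1).neg.const_cpow (Or.inl h4π)))).differentiableWithinAt

/-- `A(1) = 1/(16π³)`. [folklore] -/
theorem rankinArch_one : rankinArch 1 = ((1 / (16 * π ^ 3) : ℝ) : ℂ) := by
  have hπ : (π : ℂ) ≠ 0 := by exact_mod_cast Real.pi_ne_zero
  have h4π0 : (0 : ℝ) ≤ 4 * π := by positivity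
  have hG2 : Complex.Gamma ((1 : ℂ) + 1) = 1 := by
    rw [Complex.Gamma_add_one 1 one_ne_zero, Complex.Gamma_one, mul_one]
  rw [rankinArch, Complex.Gamma_one, hG2, cpow_neg_one,
    show (-((1 : ℂ) + 1)) = ((-2 : ℝ) : ℂ) by push_cast; ring, ← Complex.ofReal_cpow h4π0]
  rw [Real.rpow_neg h4π0, show ((2 : ℝ)) = ((2 : ℕ) : ℝ) by norm_num, Real.rpow_natCast]
  push_cast
  field_simp
  ring

/-- `riemannZeta₁(s) ≠ 0` for `Re s ≥ 1` (`ζ(s) ≠ 0` there, `riemannZeta₁ = (s − 1)ζ` off `1`,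
`riemannZeta₁(1) = 1`). [folklore] -/
theorem riemannZeta₁_ne_zero_of_one_le_re' {s : ℂ} (hs : 1 ≤ s.re) : riemannZeta₁ s ≠ 0 := by
  rcases eq_or_ne s 1 with rfl | h1
  · rw [riemannZeta₁_one]; exact one_ne_zero
  · intro h
    have hζ := riemannZeta_eq_inv_sub_mul h1
    rw [h, mul_zero] at hζ
    exact riemannZeta_ne_zero_of_one_le_re hs hζ

/-- **The uniform radius.** There is `r ∈ (0, 1/4]` such that every `s` with `|s − 2| < 1 + 2r` has
`Re s > 0` and `riemannZeta₁(s) ≠ 0`. [folklore] -/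
theorem exists_siegel_radius :
    ∃ r : ℝ, 0 < r ∧ r ≤ 1 / 4 ∧ ∀ s ∈ ball (2 : ℂ) (1 + 2 * r), 0 < s.re ∧ riemannZeta₁ s ≠ 0 := by
  obtain ⟨ρ, hρ, hball⟩ := Metric.eventually_nhds_iff.mp riemannZeta₁_ne_zero_of_near_one
  refine ⟨min (1 / 4) (ρ ^ 2 / 8), lt_min (by norm_num) (by positivity), min_le_left _ _, fun s hs ↦ ?_⟩
  set r := min (1 / 4) (ρ ^ 2 / 8) with hr
  have hr4 : r ≤ 1 / 4 := min_le_left _ _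
  have hrρ : r ≤ ρ ^ 2 / 8 := min_le_right _ _
  have hr0 : 0 < r := lt_min (by norm_num) (by positivity)
  rw [mem_ball, dist_eq_norm] at hs
  have hre : 1 - 2 * r < s.re := by
    have h := abs_re_le_norm (s - 2)
    rw [sub_re, show (2 : ℂ).re = 2 from rfl] at h
    have := neg_abs_le (s.re - 2)
    linarith
  refine ⟨by linarith, ?_⟩
  rcases le_or_gt 1 s.re with h1 | h1
  · exact riemannZeta₁_ne_zero_of_one_le_re' h1
  · apply hball
    rw [dist_eq_norm]
    -- `|s − 1|² = |s − 2|² + 2 Re(s − 2) + 1 < (1 + 2r)² − 1 ≤ 8r ≤ ρ²`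
    have hnsq : ‖s - 1‖ ^ 2 = ‖s - 2‖ ^ 2 + 2 * (s.re - 2) + 1 := by
      rw [Complex.sq_norm, Complex.sq_norm, Complex.normSq_apply, Complex.normSq_apply]
      simp only [sub_re, sub_im, show (2 : ℂ).re = 2 from rfl, show (2 : ℂ).im = 0 from rfl,
        show (1 : ℂ).re = 1 from rfl, show (1 : ℂ).im = 0 from rfl]
      ring
    have hlt : ‖s - 1‖ ^ 2 < ρ ^ 2 := by
      rw [hnsq]
      have h2 : ‖s - 2‖ ^ 2 < (1 + 2 * r) ^ 2 := by
        exact pow_lt_pow_left₀ hs (norm_nonneg _) two_ne_zero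
      nlinarith
    exact (pow_lt_pow_iff_left₀ (norm_nonneg _) hρ.le two_ne_zero).mp hlt

/-! ### The function `L_f` -/

variable (N : ℕ) [NeZero N]

/-- **`L_f(s) = Λ_f(s)/(riemannZeta₁(s) A(s))`** (`= ζ(2s)L(|a|², s+1)/ζ(s)` on `Re s > 1`).
[cite: HoffsteinLockhart1994, Thm. 0.1 (the family L(s, Sym² f), up to harmless factors)] -/
def symmSqL (f : CuspForm (Gamma0 N) 2) (s : ℂ) : ℂ :=
  rankinLambda N f s / (riemannZeta₁ s * rankinArch s)

variable {N}

/-- **Holomorphy**: `L_f` is holomorphic on `{Re s > 0} ∩ {riemannZeta₁ ≠ 0}`. [cite: Rankin1939, Thm. 3] -/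
theorem differentiableOn_symmSqL (f : CuspForm (Gamma0 N) 2) :
    DifferentiableOn ℂ (symmSqL N f) {s : ℂ | 0 < s.re ∧ riemannZeta₁ s ≠ 0} := by
  refine ((differentiableOn_rankinLambda f).mono fun s hs ↦ hs.1).div
    ((differentiable_riemannZeta₁.differentiableOn).mul (differentiableOn_rankinArch.mono fun s hs ↦ hs.1))
    fun s hs ↦ mul_ne_zero hs.2 (rankinArch_ne_zero hs.1)

/-- **Holomorphy on the uniform neighbourhood of the disc.** With `r` from `exists_siegel_radius`,
`L_f` is holomorphic on the open ball `|s − 2| < 1 + 2r ⊇ closedBall 2 (1 + r)`, for every `f` and `N`.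
[cite: HoffsteinLockhart1994, Thm. 0.1 (the family)] -/
theorem differentiableOn_symmSqL_ball (f : CuspForm (Gamma0 N) 2) {r : ℝ}
    (hr : ∀ s ∈ ball (2 : ℂ) (1 + 2 * r), 0 < s.re ∧ riemannZeta₁ s ≠ 0) :
    DifferentiableOn ℂ (symmSqL N f) (ball (2 : ℂ) (1 + 2 * r)) :=
  (differentiableOn_symmSqL f).mono fun s hs ↦ hr s hs

/-- **`L_f` on `Re s > 1`**: `L_f(s) = ζ(2s) L(|a|², s+1)/ζ(s)`. [cite: Rankin1939, Thm. 3] -/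
theorem symmSqL_eq_of_one_lt_re (f : CuspForm (Gamma0 N) 2) {s : ℂ} (hs : 1 < s.re) :
    symmSqL N f s = riemannZeta (2 * s) * LSeries (fun n ↦ ((‖cuspCoeff f n‖ ^ 2 : ℝ) : ℂ)) (s + 1) /
      riemannZeta s := by
  have hs1 : s ≠ 1 := fun h ↦ by rw [h, Complex.one_re] at hs; exact lt_irrefl _ hs
  have hsub : s - 1 ≠ 0 := sub_ne_zero.mpr hs1
  have hA := rankinArch_ne_zero (s := s) (by linarith)
  have hζ₁ : riemannZeta₁ s = (s - 1) * riemannZeta s := by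
    rw [riemannZeta_eq_inv_sub_mul hs1, ← mul_assoc, mul_inv_cancel₀ hsub, one_mul]
  have hζ : riemannZeta s ≠ 0 := riemannZeta_ne_zero_of_one_le_re hs.le
  have hΓ : Complex.Gamma s ≠ 0 := Complex.Gamma_ne_zero_of_re_pos (by linarith)
  have hΓ1 : Complex.Gamma (s + 1) ≠ 0 := Complex.Gamma_ne_zero_of_re_pos (by simp; linarith)
  have hπ : (π : ℂ) ≠ 0 := by exact_mod_cast Real.pi_ne_zero
  have h4π : ((4 * π : ℝ) : ℂ) ≠ 0 := by exact_mod_cast (by positivity : (4 * π : ℝ) ≠ 0)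
  have hπs : (π : ℂ) ^ (-s) ≠ 0 := fun h ↦ hπ ((cpow_eq_zero_iff _ _).mp h).1
  have h4s : ((4 * π : ℝ) : ℂ) ^ (-(s + 1)) ≠ 0 := fun h ↦ h4π ((cpow_eq_zero_iff _ _).mp h).1
  rw [symmSqL, rankinLambda_eq_of_one_lt_re f hs, hζ₁, rankinArch]
  field_simp

/-- **`riemannZeta₁ · L_f = (s − 1) ζ(2s) L(|a|², s+1)` on `Re s > 1`** (the left side of `coeff₁`).
[cite: Rankin1939, Thm. 3] -/
theorem riemannZeta₁_mul_symmSqL (f : CuspForm (Gamma0 N) 2) {s : ℂ} (hs : 1 < s.re) :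
    riemannZeta₁ s * symmSqL N f s =
      (s - 1) * (riemannZeta (2 * s) * LSeries (fun n ↦ ((‖cuspCoeff f n‖ ^ 2 : ℝ) : ℂ)) (s + 1)) := by
  have hs1 : s ≠ 1 := fun h ↦ by rw [h, Complex.one_re] at hs; exact lt_irrefl _ hs
  have hsub : s - 1 ≠ 0 := sub_ne_zero.mpr hs1
  have hζ : riemannZeta s ≠ 0 := riemannZeta_ne_zero_of_one_le_re hs.le
  have hζ₁ : riemannZeta₁ s = (s - 1) * riemannZeta s := by
    rw [riemannZeta_eq_inv_sub_mul hs1, ← mul_assoc, mul_inv_cancel₀ hsub, one_mul]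
  rw [symmSqL_eq_of_one_lt_re f hs, hζ₁]
  field_simp

/-- **The value at `1`: `L_f(1) = 8π³ Re(f,f)/[SL₂(ℤ):Γ₀(N)]`.** [cite: Rankin1939, Thm. 3 (residue at s = k)] -/
theorem symmSqL_one (f : CuspForm (Gamma0 N) 2) :
    symmSqL N f 1 = ((8 * π ^ 3 * (peterssonProduct (Gamma0 N) 2 f f).re / gamma0Index N : ℝ) : ℂ) := by
  have hidx : (gamma0Index N : ℂ) ≠ 0 := by exact_mod_cast (gamma0Index_pos N).ne'
  have hπ : (π : ℂ) ≠ 0 := by exact_mod_cast Real.pi_ne_zero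
  rw [symmSqL, rankinLambda_one_eq, riemannZeta₁_one, one_mul, rankinArch_one]
  push_cast
  field_simp
  ring

/-- `L_f(1)` as a real number, and its positivity when `Re (f,f) > 0`. [folklore] -/
theorem symmSqL_one_re_pos (f : CuspForm (Gamma0 N) 2) (hf : 0 < (peterssonProduct (Gamma0 N) 2 f f).re) :
    0 < (symmSqL N f 1).re ∧ (symmSqL N f 1).im = 0 := by
  have hidx : (0 : ℝ) < gamma0Index N := by exact_mod_cast gamma0Index_pos N
  rw [symmSqL_one, Complex.ofReal_re, Complex.ofReal_im]
  exact ⟨by positivity, rfl⟩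

/-! ### The Dirichlet series of `riemannZeta₁ · L_f`: non-negative coefficients -/

section Coefficients

open LSeries
open scoped LSeries.notation ComplexOrder

/-- The indicator of the perfect squares, as coefficients of `ζ(2s)`. [folklore] -/
def sqInd (n : ℕ) : ℂ := if IsSquare n then 1 else 0

/-- `ζ(2s) = Σ_{n square} n^{-s}` for `Re s > 1/2` with `Re (2s) > 1`, i.e. `L(sqInd, s) = ζ(2s)` for
`Re s > 1`. [folklore] -/
theorem LSeries_sqInd {s : ℂ} (hs : 1 < s.re) : LSeries sqInd s = riemannZeta (2 * s) := by
  have h2s : 1 < (2 * s).re := by simp; linarith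
  rw [zeta_eq_tsum_one_div_nat_cpow h2s, LSeries]
  have hinj : Function.Injective fun k : ℕ ↦ k ^ 2 := Nat.pow_left_injective two_ne_zero
  have hsupp : Function.support (fun n : ℕ ↦ term sqInd s n) ⊆ Set.range fun k : ℕ ↦ k ^ 2 := by
    intro n hn
    rw [Function.mem_support] at hn
    by_contra hr
    apply hn
    rcases eq_or_ne n 0 with rfl | hn0
    · simp [term]
    · rw [term_of_ne_zero hn0, sqInd, if_neg, zero_div]
      rintro ⟨k, hk⟩
      exact hr ⟨k, by simp only [hk, sq]⟩
  rw [← hinj.tsum_eq hsupp]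
  refine tsum_congr fun k ↦ ?_
  rcases eq_or_ne k 0 with rfl | hk0
  · simp [term, show (2 : ℂ) * s ≠ 0 from
      mul_ne_zero two_ne_zero (fun h ↦ by rw [h, Complex.zero_re] at hs; linarith)]
  · have hk2 : k ^ 2 ≠ 0 := pow_ne_zero 2 hk0
    rw [term_of_ne_zero hk2, sqInd, if_pos ⟨k, sq k⟩, Nat.cast_pow]
    have hk : (0 : ℝ) < k := by exact_mod_cast Nat.pos_of_ne_zero hk0
    have hlog : (Complex.log (k : ℂ) * 2).im = 0 := by
      rw [← Complex.ofReal_natCast, ← Complex.ofReal_log hk.le, show (2 : ℂ) = ((2 : ℝ) : ℂ) by norm_num,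
        ← Complex.ofReal_mul, Complex.ofReal_im]
    rw [show ((k : ℂ)) ^ 2 = (k : ℂ) ^ ((2 : ℂ)) by norm_cast, ← Complex.cpow_mul _ (by rw [hlog]; linarith [Real.pi_pos])
      (by rw [hlog]; exact Real.pi_pos.le), mul_comm]

/-- `L(sqInd, s)` converges absolutely for `Re s > 1`. [folklore] -/
theorem LSeriesSummable_sqInd {s : ℂ} (hs : 1 < s.re) : LSeriesSummable sqInd s :=
  LSeriesSummable_of_bounded_of_one_lt_re (m := 1) (fun n _ ↦ by
    unfold sqInd; split_ifs <;> simp) hs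

variable {N : ℕ} [NeZero N]

/-- The shifted coefficients `cₙ = |aₙ|²/n`. [folklore] -/
def normSqCoeffDiv (f : CuspForm (Gamma0 N) 2) (n : ℕ) : ℂ := ((‖cuspCoeff f n‖ ^ 2 / n : ℝ) : ℂ)

omit [NeZero N] in
/-- The shift: `term (|a|², s+1) n = term (|a|²/n, s) n`. [folklore] -/
theorem term_normSq_add_one (f : CuspForm (Gamma0 N) 2) (s : ℂ) (n : ℕ) :
    term (fun n ↦ ((‖cuspCoeff f n‖ ^ 2 : ℝ) : ℂ)) (s + 1) n = term (normSqCoeffDiv f) s n := by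
  rcases eq_or_ne n 0 with rfl | hn
  · simp [term]
  · have hn' : (n : ℂ) ≠ 0 := by exact_mod_cast hn
    rw [term_of_ne_zero hn, term_of_ne_zero hn, normSqCoeffDiv, Complex.cpow_add _ _ hn', Complex.cpow_one]
    push_cast
    field_simp

omit [NeZero N] in
/-- `L(|a|², s+1) = L(|a|²/n, s)`. [folklore] -/
theorem LSeries_normSq_add_one (f : CuspForm (Gamma0 N) 2) (s : ℂ) :
    LSeries (fun n ↦ ((‖cuspCoeff f n‖ ^ 2 : ℝ) : ℂ)) (s + 1) = LSeries (normSqCoeffDiv f) s := by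
  rw [LSeries, LSeries]; exact tsum_congr (term_normSq_add_one f s)

/-- `L(|a|²/n, s)` converges absolutely for `Re s > 1`. [folklore] -/
theorem LSeriesSummable_normSqCoeffDiv (f : CuspForm (Gamma0 N) 2) {s : ℂ} (hs : 1 < s.re) :
    LSeriesSummable (normSqCoeffDiv f) s := by
  have h : LSeriesSummable (fun n ↦ ((‖cuspCoeff f n‖ ^ 2 : ℝ) : ℂ)) (s + 1) := by
    refine LSeriesSummable_of_abscissaOfAbsConv_lt_re ((abscissaOfAbsConv_normSq_cuspCoeff_le f).trans_lt ?_)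
    exact EReal.coe_lt_coe_iff.mpr (by simp; linarith)
  unfold LSeriesSummable at h ⊢
  exact h.congr (term_normSq_add_one f s)

/-- **The coefficients of `riemannZeta₁ · L_f`**: `b = sqInd ⍟ (|a|²/n)`,
`b(n) = Σ_{d²m = n} |a_m|²/m ≥ 0`, `b(1) = |a₁|²`. [cite: Rankin1939, §4 (ζ(2s)Σ|aₙ|²n^{-s})] -/
def rankinCoeff (f : CuspForm (Gamma0 N) 2) : ℕ → ℂ := sqInd ⍟ normSqCoeffDiv f

omit [NeZero N] in
/-- `b ≥ 0`. [folklore] -/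
theorem rankinCoeff_nonneg (f : CuspForm (Gamma0 N) 2) : 0 ≤ rankinCoeff f := by
  intro n
  rw [rankinCoeff, convolution_def]
  refine Finset.sum_nonneg fun p _ ↦ mul_nonneg ?_ ?_
  · unfold sqInd; split_ifs <;> simp
  · unfold normSqCoeffDiv; exact Complex.zero_le_real.mpr (by positivity)

omit [NeZero N] in
/-- `b(1) = |a₁|²`. [folklore] -/
theorem rankinCoeff_one (f : CuspForm (Gamma0 N) 2) : rankinCoeff f 1 = ((‖cuspCoeff f 1‖ ^ 2 : ℝ) : ℂ) := by
  rw [rankinCoeff, convolution_def]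
  simp [sqInd, normSqCoeffDiv]

/-- `L(b, s)` converges absolutely for `Re s > 1`. [folklore] -/
theorem LSeriesSummable_rankinCoeff (f : CuspForm (Gamma0 N) 2) {s : ℂ} (hs : 1 < s.re) :
    LSeriesSummable (rankinCoeff f) s :=
  (LSeriesSummable_sqInd hs).convolution (LSeriesSummable_normSqCoeffDiv f hs)

/-- **`coeff₁` for `L_f`**: for `Re s > 1`, `riemannZeta₁(s) · L_f(s) = (s − 1) · L(b, s)` with
`b = rankinCoeff f ≥ 0`, `b(1) = |a₁|²` (`= 1` for a normalised form). [cite: Rankin1939, Thm. 3] -/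
theorem riemannZeta₁_mul_symmSqL_eq_LSeries (f : CuspForm (Gamma0 N) 2) {s : ℂ} (hs : 1 < s.re) :
    riemannZeta₁ s * symmSqL N f s = (s - 1) * LSeries (rankinCoeff f) s := by
  rw [riemannZeta₁_mul_symmSqL f hs, rankinCoeff,
    LSeries_convolution' (LSeriesSummable_sqInd hs) (LSeriesSummable_normSqCoeffDiv f hs),
    LSeries_sqInd hs, LSeries_normSq_add_one]

/-- **The field `coeff₁` in the exact shape of `SiegelPairFamilyData`** for a normalised form
(`a₁(f) = 1`). [cite: HoffsteinLockhart1994, Thm. 0.1 (the family)] -/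
theorem symmSqL_coeff₁ (f : CuspForm (Gamma0 N) 2) (h1 : cuspCoeff f 1 = 1) :
    ∃ a : ℕ → ℂ, 0 ≤ a ∧ a 1 = 1 ∧ (∀ s : ℂ, 1 < s.re → LSeriesSummable a s) ∧
      ∀ s : ℂ, 1 < s.re → riemannZeta₁ s * symmSqL N f s = (s - 1) * LSeries a s :=
  ⟨rankinCoeff f, rankinCoeff_nonneg f, by rw [rankinCoeff_one, h1]; simp,
    fun _ hs ↦ LSeriesSummable_rankinCoeff f hs, fun _ hs ↦ riemannZeta₁_mul_symmSqL_eq_LSeries f hs⟩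

end Coefficients

/-! ### Reality on the real diameter (Schwarz reflection) -/

section Reality

open scoped ComplexConjugate

/-- Identity theorem from a real INTERVAL: two functions holomorphic on an open preconnected `U`
containing the real points of `(a, b)` and equal there coincide on `U`. [folklore] -/
theorem eqOn_of_differentiableOn_of_eq_on_Ioo {U : Set ℂ} (hU : IsOpen U) (hUc : IsPreconnected U)
    {F G : ℂ → ℂ} (hF : DifferentiableOn ℂ F U) (hG : DifferentiableOn ℂ G U) {a b : ℝ} (hab : a < b)
    (hmem : ∀ σ : ℝ, a < σ → σ < b → (σ : ℂ) ∈ U) (heq : ∀ σ : ℝ, a < σ → σ < b → F σ = G σ) :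
    EqOn F G U := by
  set c : ℝ := (a + b) / 2 with hc
  have hca : a < c := by rw [hc]; linarith
  have hcb : c < b := by rw [hc]; linarith
  refine (hF.analyticOnNhd hU).eqOn_of_preconnected_of_frequently_eq (hG.analyticOnNhd hU) hUc
    (hmem c hca hcb) ?_
  rw [Filter.frequently_iff]
  intro V hV
  obtain ⟨ε, hε, hball⟩ := Metric.mem_nhdsWithin_iff.mp hV
  set δ : ℝ := min (ε / 2) ((b - c) / 2) with hδ
  have hδ0 : 0 < δ := lt_min (by linarith) (by linarith)
  have hδε : δ ≤ ε / 2 := min_le_left _ _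
  have hδb : δ ≤ (b - c) / 2 := min_le_right _ _
  refine ⟨((c + δ : ℝ) : ℂ), hball ⟨?_, ?_⟩, heq _ (by linarith) (by linarith)⟩
  · rw [Metric.mem_ball, dist_eq_norm, ← Complex.ofReal_sub, Complex.norm_real, Real.norm_eq_abs,
      show c + δ - c = δ by ring, abs_of_pos hδ0]
    linarith
  · simp only [mem_compl_iff, mem_singleton_iff, Complex.ofReal_inj]
    intro h; linarith

/-- `ζ(x)` is real for real `x > 1`. [folklore] -/
theorem riemannZeta_ofReal_im_eq_zero {x : ℝ} (hx : 1 < x) : (riemannZeta x).im = 0 := by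
  rw [zeta_eq_tsum_one_div_nat_cpow (by simpa using hx)]
  have h : (∑' n : ℕ, 1 / (n : ℂ) ^ (x : ℂ)) = ((∑' n : ℕ, 1 / (n : ℝ) ^ x : ℝ) : ℂ) := by
    rw [Complex.ofReal_tsum]
    refine tsum_congr fun n ↦ ?_
    rw [← Complex.ofReal_natCast, ← Complex.ofReal_cpow (Nat.cast_nonneg n)]
    push_cast; rfl
  rw [h, Complex.ofReal_im]

variable {N : ℕ} [NeZero N]

/-- `L_f(σ)` is real for real `σ > 1` (a quotient of real series). [folklore] -/
theorem symmSqL_ofReal_im_eq_zero_of_one_lt (f : CuspForm (Gamma0 N) 2) {σ : ℝ} (hσ : 1 < σ) :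
    (symmSqL N f σ).im = 0 := by
  have hx : σ + 1 ≠ 0 := by linarith
  rw [symmSqL_eq_of_one_lt_re f (by simpa using hσ), show (2 : ℂ) * (σ : ℂ) = ((2 * σ : ℝ) : ℂ) by push_cast; ring,
    show ((σ : ℂ) + 1) = ((σ + 1 : ℝ) : ℂ) by push_cast; ring, LSeries_ofReal_apply_ofReal _ hx]
  have h1im := riemannZeta_ofReal_im_eq_zero (by linarith : (1 : ℝ) < 2 * σ)
  have h2im := riemannZeta_ofReal_im_eq_zero hσ
  have h1 : (riemannZeta ((2 * σ : ℝ) : ℂ)) = (((riemannZeta ((2 * σ : ℝ) : ℂ)).re : ℝ) : ℂ) :=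
    Complex.ext (by simp) (by rw [Complex.ofReal_im]; exact h1im)
  have h2 : (riemannZeta (σ : ℂ)) = (((riemannZeta (σ : ℂ)).re : ℝ) : ℂ) :=
    Complex.ext (by simp) (by rw [Complex.ofReal_im]; exact h2im)
  rw [h1, h2, ← Complex.ofReal_mul, ← Complex.ofReal_div, Complex.ofReal_im]

/-- **`L_f` is real on the real diameter of the uniform ball** (Schwarz reflection on the conjugation-stable
ball `|s − 2| < 1 + 2r`: `s ↦ conj L_f(s̄)` is holomorphic there and agrees with `L_f` on `(1, 3)`).
[cite: HoffsteinLockhart1994, Thm. 0.1 (the family; real coefficients)] -/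
theorem symmSqL_ofReal_im_eq_zero (f : CuspForm (Gamma0 N) 2) {r : ℝ} (hr0 : 0 ≤ r)
    (hr : ∀ s ∈ ball (2 : ℂ) (1 + 2 * r), 0 < s.re ∧ riemannZeta₁ s ≠ 0)
    {σ : ℝ} (hσ : (σ : ℂ) ∈ ball (2 : ℂ) (1 + 2 * r)) : (symmSqL N f σ).im = 0 := by
  set U : Set ℂ := ball (2 : ℂ) (1 + 2 * r) with hUdef
  have hU : IsOpen U := isOpen_ball
  have hUc : IsPreconnected U := (convex_ball _ _).isPreconnected
  have hsymm : ∀ s ∈ U, conj s ∈ U := by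
    intro s hs
    rw [hUdef, mem_ball, dist_eq_norm] at hs ⊢
    rwa [show conj s - 2 = conj (s - 2) by
      rw [map_sub, show (conj (2 : ℂ)) = 2 from Complex.conj_ofNat 2], Complex.norm_conj]
  have hg : DifferentiableOn ℂ (symmSqL N f) U := differentiableOn_symmSqL_ball f hr
  set g' : ℂ → ℂ := fun s ↦ conj (symmSqL N f (conj s)) with hg'
  have hg'd : DifferentiableOn ℂ g' U := by
    intro z hz
    have hd : DifferentiableAt ℂ (symmSqL N f) (conj z) := hg.differentiableAt (hU.mem_nhds (hsymm z hz))
    exact (differentiableAt_conj_conj_iff.mpr hd).differentiableWithinAt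
  have hmem : ∀ σ : ℝ, 1 < σ → σ < 3 → (σ : ℂ) ∈ U := by
    intro σ h1 h3
    rw [hUdef, mem_ball, dist_eq_norm, ← Complex.ofReal_ofNat, ← Complex.ofReal_sub, Complex.norm_real,
      Real.norm_eq_abs, abs_lt]
    constructor <;> linarith
  have heq : ∀ σ : ℝ, 1 < σ → σ < 3 → g' σ = symmSqL N f σ := by
    intro σ h1 _
    simp only [hg', Complex.conj_ofReal]
    exact Complex.conj_eq_iff_im.mpr (symmSqL_ofReal_im_eq_zero_of_one_lt f h1)
  have hEq := eqOn_of_differentiableOn_of_eq_on_Ioo hU hUc hg'd hg (by norm_num : (1 : ℝ) < 3) hmem heq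
  have h := hEq hσ
  simp only [hg', Complex.conj_ofReal] at h
  exact Complex.conj_eq_iff_im.mp h

end Reality

end Literature.NumberTheory.EllipticCurves.ModularForms

end
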